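import Summits.ABC.ABC.Theorems.TwistAmplificationMazurKaneLawDECauchySchwarz

-- Summit.ABC.ABC is the mandated summit-side namespace (single-conjunct summit); the lakefile sets the same option tree-wide.
set_option linter.dupNamespace false

/-!
# Ratio Cauchy–Schwarz on one modulus, sum form (crux stmt-ABC-2757, stub `de_fibre_card_le_sqrt_sum`)

Helper file for the line `critical-kloosterman-powerful-moduli` of the crux
`Summit.ABC.ABC.Theses.TwistAmplification.MazurKaneLaw` (DE tool, the dispersion step): the
registered stub `de_fibre_card_le_sqrt_sum`, the SUM form of "ratio Cauchy–Schwarz on one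
modulus" (host = the `z`-term), a variant of `de_fibre_card_le_sqrt_coprime`.

Fix a modulus `q ≥ 1`, coefficients `c₂, c₃ ≥ 1`, dyadic boxes with corners `Y, Z` and the linear
coordinate `i₀` (the coordinate `0`, carrying the exponent `1`).  For `(y, z)` in the boxes put
`a = c₂ ∏ yᵢ^{i+1}` and `b = c₃ ∏ zᵢ^{i+1}` (the two summands of `a + b = c`, with `q ∣ c`); the
quantity bounded is the number of `(y, z)` with `a, b` coprime to `q` and `a + b ≡ 0 (mod q)`.
Split `y = (y₀, r₂)`, `z = (z₀, r₃)` with `y₀ = y i₀` and `r₂` the tuple frozen at `i₀`, so that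
`a = y₀ · m(r₂)`, `b = z₀ · n(r₃)` with `m = c₂ · offVal`, `n = c₃ · offVal`.  All four of
`y₀, z₀, m, n` are units modulo `q`, and the congruence says that the ratios `y₀ / z₀` and
`-n(r₃) / m(r₂)` agree in `ZMod q`.  Counting by the common ratio and applying Cauchy–Schwarz
(`de_card_filter_prod_le_sqrt`) bounds the count by the geometric mean of the two multiplicative
energies `#{q ∣ y₀ z₀' − y₀' z₀}` and `#{q ∣ m(r₂') n(r₃) − m(r₂) n(r₃')}` (the latter over pairs
all of whose four factors are units modulo `q`); the sign disappears in the energies.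

Everything here is folklore bookkeeping; the abstract Cauchy–Schwarz step and the splitting
lemmas are imported from the file of `de_fibre_card_le_sqrt_coprime`.
-/

namespace Summit.ABC.ABC.Theorems.MazurKaneLaw

open Finset
open Literature.NumberTheory.DiophantineGeometry
open Literature.NumberTheory.DiophantineGeometry.AbcShapes

/-- **Ratio Cauchy–Schwarz on one modulus, sum form** (DE tool piece of the dispersion step, host
the `z`-term).  For a modulus `q ≥ 1`, the pairs `(y, z)` of shape tuples in the dyadic boxes with
`a = c₂ ∏ yᵢ^{i+1}` and `b = c₃ ∏ zᵢ^{i+1}` both coprime to `q` and `q ∣ a + b` number at most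
`√E₁ · √E₂`, where `E₁ = #{(y₀, z₀, y₀', z₀') : q ∣ y₀ z₀' − y₀' z₀}` is the multiplicative energy
of the linear coordinates and `E₂` the one of the frozen parts `m(r₂) = c₂ offVal r₂`,
`n(r₃) = c₃ offVal r₃` (over quadruples of units modulo `q`).  Proof: `(y, z) ↦ ((y₀, z₀), (r₂, r₃))`
injects into `{f = g}` for the ratio maps `f = y₀ z₀⁻¹`, `g = (-n) m⁻¹` into `ZMod q`, then
`de_card_filter_prod_le_sqrt` and `f a = f a' ⇒ q ∣ y₀ z₀' − y₀' z₀`, `g b = g b' ⇒ q ∣ m' n − m n'`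
(cross-multiplication by units; the signs cancel). [folklore] -/
theorem de_fibre_card_le_sqrt_sum : ∀ {d : ℕ} (i₀ : Fin d), (i₀ : ℕ) = 0 → ∀ (q c₂ c₃ : ℕ), 0 < q → 0 < c₂ → 0 < c₃ → ∀ (Y Z : Fin d → ℕ), (∀ j, 0 < Y j) → (∀ j, 0 < Z j) → ((((dyadicBox Y ×ˢ dyadicBox Z).filter (fun t : (Fin d → ℕ) × (Fin d → ℕ) => Nat.Coprime q (c₂ * shapeVal t.1) ∧ Nat.Coprime q (c₃ * shapeVal t.2) ∧ (q : ℤ) ∣ ((c₂ * shapeVal t.1 : ℕ) : ℤ) + ((c₃ * shapeVal t.2 : ℕ) : ℤ))).card : ℕ) : ℝ) ≤ Real.sqrt ((((Finset.Ico (Y i₀) (2 * Y i₀) ×ˢ Finset.Ico (Z i₀) (2 * Z i₀)) ×ˢ (Finset.Ico (Y i₀) (2 * Y i₀) ×ˢ Finset.Ico (Z i₀) (2 * Z i₀))).filter (fun p : (ℕ × ℕ) × (ℕ × ℕ) => (q : ℤ) ∣ ((p.1.1 * p.2.2 : ℕ) : ℤ) - ((p.2.1 * p.1.2 : ℕ)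 : ℤ))).card : ℝ) * Real.sqrt ((((subBox {i₀} Y ×ˢ subBox {i₀} Z) ×ˢ (subBox {i₀} Y ×ˢ subBox {i₀} Z)).filter (fun p : ((Fin d → ℕ) × (Fin d → ℕ)) × ((Fin d → ℕ) × (Fin d → ℕ)) => Nat.Coprime q (c₂ * offVal {i₀} p.1.1) ∧ Nat.Coprime q (c₃ * offVal {i₀} p.1.2) ∧ Nat.Coprime q (c₂ * offVal {i₀} p.2.1) ∧ Nat.Coprime q (c₃ * offVal {i₀} p.2.2) ∧ (q : ℤ) ∣ ((c₂ * offVal {i₀} p.2.1 * (c₃ * offVal {i₀} p.1.2) : ℕ) : ℤ) - ((c₂ * offVal {i₀} p.1.1 * (c₃ * offVal {i₀} p.2.2) : ℕ) : ℤ))).card : ℝ) := by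
  intro d i₀ hi₀ q c₂ c₃ hq _hc₂ _hc₃ Y Z _hY _hZ
  haveI : NeZero q := ⟨hq.ne'⟩
  -- the unit sets `U`, `V` and the ratio maps `f`, `g` (`g` carries the sign of `a + b ≡ 0`)
  obtain ⟨U, hU⟩ : ∃ U : Finset (ℕ × ℕ), U = (Finset.Ico (Y i₀) (2 * Y i₀) ×ˢ
      Finset.Ico (Z i₀) (2 * Z i₀)).filter (fun a : ℕ × ℕ => Nat.Coprime q a.2) := ⟨_, rfl⟩
  obtain ⟨V, hV⟩ : ∃ V : Finset ((Fin d → ℕ) × (Fin d → ℕ)), V = (subBox {i₀} Y ×ˢ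
      subBox {i₀} Z).filter (fun b : (Fin d → ℕ) × (Fin d → ℕ) =>
        Nat.Coprime q (c₂ * offVal {i₀} b.1) ∧ Nat.Coprime q (c₃ * offVal {i₀} b.2)) := ⟨_, rfl⟩
  obtain ⟨f, hf⟩ : ∃ f : ℕ × ℕ → ZMod q,
      f = fun a => (a.1 : ZMod q) * ((a.2 : ZMod q))⁻¹ := ⟨_, rfl⟩
  obtain ⟨g, hg⟩ : ∃ g : (Fin d → ℕ) × (Fin d → ℕ) → ZMod q, g = fun b =>
      (-((c₃ * offVal {i₀} b.2 : ℕ) : ZMod q)) * (((c₂ * offVal {i₀} b.1 : ℕ) : ZMod q))⁻¹ :=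
    ⟨_, rfl⟩
  /- Step 1: `(y, z) ↦ ((y₀, z₀), (r₂, r₃))` injects the counted set into `{(a, b) ∈ U × V : f a = g b}`. -/
  have h1 : ((dyadicBox Y ×ˢ dyadicBox Z).filter (fun t : (Fin d → ℕ) × (Fin d → ℕ) =>
      Nat.Coprime q (c₂ * shapeVal t.1) ∧ Nat.Coprime q (c₃ * shapeVal t.2) ∧
        (q : ℤ) ∣ ((c₂ * shapeVal t.1 : ℕ) : ℤ) + ((c₃ * shapeVal t.2 : ℕ) : ℤ))).card ≤
      ((U ×ˢ V).filter (fun p => f p.1 = g p.2)).card := by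
    refine card_le_card_of_injOn
      (fun t => ((t.1 i₀, t.2 i₀), (freezeOn {i₀} Y t.1, freezeOn {i₀} Z t.2)))
      (fun t ht => ?_) (fun t ht t' ht' h => ?_)
    · obtain ⟨hbox, hb, hc, hdvd⟩ := mem_filter.mp (mem_coe.mp ht)
      obtain ⟨hy, hz⟩ := mem_product.mp hbox
      have hy0 := (mem_dyadicBox.mp hy) i₀
      have hz0 := (mem_dyadicBox.mp hz) i₀
      simp only [de_shapeVal_eq_mul_offVal hi₀] at hb hc hdvd
      -- the four units
      have hz0u : Nat.Coprime q (t.2 i₀) :=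
        hc.coprime_dvd_right ⟨c₃ * offVal {i₀} t.2, by ring⟩
      have hmu : Nat.Coprime q (c₂ * offVal {i₀} t.1) :=
        hb.coprime_dvd_right ⟨t.1 i₀, by ring⟩
      have hnu : Nat.Coprime q (c₃ * offVal {i₀} t.2) :=
        hc.coprime_dvd_right ⟨t.2 i₀, by ring⟩
      refine mem_coe.mpr (mem_filter.mpr ⟨mem_product.mpr ⟨?_, ?_⟩, ?_⟩)
      · rw [hU]
        exact mem_filter.mpr ⟨mem_product.mpr ⟨mem_Ico.mpr hy0, mem_Ico.mpr hz0⟩, hz0u⟩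
      · rw [hV]
        refine mem_filter.mpr ⟨mem_product.mpr
          ⟨freezeOn_mem_subBox _ hy, freezeOn_mem_subBox _ hz⟩, ?_, ?_⟩
        · dsimp only
          rw [offVal_freezeOn]
          exact hmu
        · dsimp only
          rw [offVal_freezeOn]
          exact hnu
      · -- the congruence `y₀ m + z₀ n ≡ 0` says `f (y₀, z₀) = g (r₂, r₃)`
        rw [hf, hg]
        dsimp only
        rw [offVal_freezeOn, offVal_freezeOn]
        refine (de_zmod_div_eq_div_iff ((ZMod.isUnit_iff_coprime _ q).mpr hz0u.symm)
          ((ZMod.isUnit_iff_coprime _ q).mpr hmu.symm)).mpr ?_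
        have hcong := (ZMod.intCast_zmod_eq_zero_iff_dvd _ q).mpr hdvd
        push_cast at hcong ⊢
        linear_combination hcong
    · -- injectivity: a tuple is its `i₀`-coordinate plus its freezing at `i₀`
      simp only [Prod.mk.injEq] at h
      obtain ⟨⟨h₁, h₂⟩, h₃, h₄⟩ := h
      exact Prod.ext (de_eq_of_freezeOn_eq h₁ h₃) (de_eq_of_freezeOn_eq h₂ h₄)
  /- Step 2: the two energies of the ratio maps sit inside the registered energy sets. -/
  have h3 : ((U ×ˢ U).filter (fun p => f p.1 = f p.2)).card ≤
      (((Finset.Ico (Y i₀) (2 * Y i₀) ×ˢ Finset.Ico (Z i₀) (2 * Z i₀)) ×ˢ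
        (Finset.Ico (Y i₀) (2 * Y i₀) ×ˢ Finset.Ico (Z i₀) (2 * Z i₀))).filter
        (fun p : (ℕ × ℕ) × (ℕ × ℕ) =>
          (q : ℤ) ∣ ((p.1.1 * p.2.2 : ℕ) : ℤ) - ((p.2.1 * p.1.2 : ℕ) : ℤ))).card := by
    refine card_le_card fun p hp => ?_
    obtain ⟨hUU, hfp⟩ := mem_filter.mp hp
    rw [hU] at hUU
    obtain ⟨ha, ha'⟩ := mem_product.mp hUU
    obtain ⟨haI, hau⟩ := mem_filter.mp ha
    obtain ⟨haI', hau'⟩ := mem_filter.mp ha'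
    refine mem_filter.mpr ⟨mem_product.mpr ⟨haI, haI'⟩, ?_⟩
    rw [hf] at hfp
    dsimp only at hfp
    have key := (de_zmod_div_eq_div_iff ((ZMod.isUnit_iff_coprime _ q).mpr hau.symm)
      ((ZMod.isUnit_iff_coprime _ q).mpr hau'.symm)).mp hfp
    refine (de_natCast_zmod_eq_iff_dvd_sub q _ _).mp ?_
    push_cast at key ⊢
    linear_combination -key
  have h4 : ((V ×ˢ V).filter (fun p => g p.1 = g p.2)).card ≤
      (((subBox {i₀} Y ×ˢ subBox {i₀} Z) ×ˢ (subBox {i₀} Y ×ˢ subBox {i₀} Z)).filter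
        (fun p : ((Fin d → ℕ) × (Fin d → ℕ)) × ((Fin d → ℕ) × (Fin d → ℕ)) =>
          Nat.Coprime q (c₂ * offVal {i₀} p.1.1) ∧ Nat.Coprime q (c₃ * offVal {i₀} p.1.2) ∧
          Nat.Coprime q (c₂ * offVal {i₀} p.2.1) ∧ Nat.Coprime q (c₃ * offVal {i₀} p.2.2) ∧
          (q : ℤ) ∣ ((c₂ * offVal {i₀} p.2.1 * (c₃ * offVal {i₀} p.1.2) : ℕ) : ℤ) -
            ((c₂ * offVal {i₀} p.1.1 * (c₃ * offVal {i₀} p.2.2) : ℕ) : ℤ))).card := by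
    refine card_le_card fun p hp => ?_
    obtain ⟨hVV, hgp⟩ := mem_filter.mp hp
    rw [hV] at hVV
    obtain ⟨hb, hb'⟩ := mem_product.mp hVV
    obtain ⟨hbR, hmu, hnu⟩ := mem_filter.mp hb
    obtain ⟨hbR', hmu', hnu'⟩ := mem_filter.mp hb'
    refine mem_filter.mpr ⟨mem_product.mpr ⟨hbR, hbR'⟩, hmu, hnu, hmu', hnu', ?_⟩
    rw [hg] at hgp
    dsimp only at hgp
    have key := (de_zmod_div_eq_div_iff ((ZMod.isUnit_iff_coprime _ q).mpr hmu.symm)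
      ((ZMod.isUnit_iff_coprime _ q).mpr hmu'.symm)).mp hgp
    refine (de_natCast_zmod_eq_iff_dvd_sub q _ _).mp ?_
    push_cast at key ⊢
    linear_combination key
  /- Step 3: Cauchy–Schwarz and monotonicity of the square root. -/
  have h1' := (Nat.cast_le (α := ℝ)).mpr h1
  have h3' := (Nat.cast_le (α := ℝ)).mpr h3
  have h4' := (Nat.cast_le (α := ℝ)).mpr h4
  exact h1'.trans ((de_card_filter_prod_le_sqrt U V f g).trans
    (mul_le_mul (Real.sqrt_le_sqrt h3') (Real.sqrt_le_sqrt h4') (Real.sqrt_nonneg _)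
      (Real.sqrt_nonneg _)))

end Summit.ABC.ABC.Theorems.MazurKaneLaw
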